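import Literature.Probability.RandomPlanarGeometry.LSW2004UST
import Literature.Probability.RandomPlanarGeometry.USTPeanoLocal
import HarnessLib

/-!
# [LSW04] §4.1: every `D ∈ 𝔇*` has a UST Peano path — `USTPeano.nonempty_peanoPath` discharged

G. F. Lawler, O. Schramm, W. Werner, *Conformal invariance of planar loop-erased random walks and
uniform spanning trees*, Ann. Probab. **32** (2004), §4.1, pp. 971–972: the map `T ↦ γ(T)` is a
bijection between the spanning trees of `H` containing `α` and "the set of oriented paths in
`G⃗ ∩ D̄` from `a` to `b` containing `V_P`"; in particular this set — the type
`USTPeano.PeanoPath D` — is nonempty, which is the named fact `USTPeano.nonempty_peanoPath` of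
`LSW2004UST.lean` (it makes the UST law `ustLaw D` a probability measure).

We prove it (`USTPeano.nonempty_peanoPath_holds`) without spanning trees, by the peeling
induction of `USTPeanoPeelingStep.lean` (the Markov structure of [LSW04] Lemma 4.1) applied to
the peeling data of `D` (`USTPeanoLocal.lean`: the axioms hold, by the local analysis of the
Jordan domain `D` at `a`), and the translation of combinatorial paths into `PeanoPath`
(`USTPeano.Domain.peanoPath`: the edges avoid `α ∪ β` by `USTPeanoSegments.lean`).
-/

noncomputable section

open Set

namespace Literature.Probability.RandomPlanarGeometry

namespace USTPeano

namespace Domain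

variable (D : Domain)

/-- **A combinatorial Peano path of the peeling data is a Peano path of the domain.**
[cite: LawlerSchrammWerner2004, §4.1] -/
def peanoPath {l : List (ℤ × ℤ)} (hl : D.peelData.IsPath l) : PeanoPath D where
  verts := l
  ne_nil := hl.ne_nil
  head_eq := hl.head_eq
  getLast_eq := hl.getLast_eq
  isChain := hl.isChain
  nodup := hl.nodup
  mem_iff p := by rw [hl.mem_iff p, mem_peelData_V, mem_peanoVerts]; rfl
  disjoint_edge e he := by
    have hm : Manhattan e.1 e.2 := forall_zip_tail_of_isChain hl.isChain e he
    obtain ⟨hP, hD⟩ := D.forall_not_of_not_blocked (hl.unblocked e he)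
    exact Disjoint.union_right (disjoint_segment_primalPathSet D.isChain_α hm hP)
      (disjoint_segment_dualPathSet D.isChain_β hm hD)

end Domain

/-- **[LSW04] §4.1: every `D ∈ 𝔇*` has a Peano path** — the named fact
`USTPeano.nonempty_peanoPath` holds. [cite: LawlerSchrammWerner2004, §4.1] -/
theorem nonempty_peanoPath_holds : nonempty_peanoPath := fun D ↦
  let ⟨_, hl⟩ := D.good_peelData.exists_isPath
  ⟨D.peanoPath hl⟩

end USTPeano

end Literature.Probability.RandomPlanarGeometry
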